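import Summits.Parity.GeneralizedHardyLittlewood.Theorems.LiouvilleShiftedTablesSieveToMAvgI2Defs

/-!
# Sieve glue for `SieveToMAvg`, part 7b: Type I₂ — the local decomposition

Support file for item stmt-Parity-14274 (route `LiouvilleShiftedTables`).  Fix `q`, `r`, `s` with
`rs ∈ (P₀, (1+Δ)² P₀]`.  The sum of `λ(rsn' − h)` over `n' ∈ (n₁, n₂]` with the cross-condition
`x < rsn' ≤ 2x` and the congruence `rsn' ≡ h (q)` equals the HYPERBOLIC sum over
`L* < rsn' ≤ M` (`M = min(2x, P₀ n₂)`, `L = max(x, (1+Δ)² P₀ n₁)`, `L* = min(L, M)`), up to the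
terms with `n'` in the two thin sets `(n₁, (1+Δ)² n₁]`, `(n₂/(1+Δ)², n₂]` (`boxCrossSum_decomp`).
The hyperbolic sums are exactly the inner sums of `regionSum` (part 7a), hence differences of the
crux's sums `Dsum`.
-/

namespace Summit.Parity.GeneralizedHardyLittlewood.Theorems.SieveToMAvg

open Finset Real
open scoped ArithmeticFunction.zeta ArithmeticFunction.sigma
open Literature.NumberTheory.Sieve.BFI

section Local

variable (h q r s : ℕ) (x Δ P₀ n₁ n₂ : ℝ)

/-- The box-and-cross sum: `∑_{n' : n₁ < n' ≤ n₂, x < rsn' ≤ 2x, rsn' ≡ h (q)} λ(rsn' − h)`. [folklore] -/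
noncomputable def boxCrossSum : ℝ :=
  ∑ n ∈ Ioc 0 ⌊2 * x⌋₊, if (n₁ < n ∧ (n : ℝ) ≤ n₂) ∧
    (⌊x⌋₊ < r * s * n ∧ r * s * n ≤ ⌊2 * x⌋₊ ∧ r * s * n ≡ h [MOD q]) then lamW h (r * s * n) else 0

/-- The upper cut `M = min(2x, P₀ n₂)`. [folklore] -/
noncomputable def cutM : ℝ := min (2 * x) (P₀ * n₂)

/-- The lower cut `L* = min(max(x, (1+Δ)² P₀ n₁), M)`. [folklore] -/
noncomputable def cutL : ℝ := min (max x ((1 + Δ) ^ 2 * P₀ * n₁)) (cutM x P₀ n₂)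

/-- The hyperbolic sum `∑_{L* < rsn' ≤ M, rsn' ≡ h (q)} λ(rsn' − h)` (the inner sum of `regionSum`). [folklore] -/
noncomputable def hypSum : ℝ :=
  ∑ n ∈ (Icc 1 ⌊cutM x P₀ n₂ / (s * r)⌋₊).filter
    (fun n : ℕ => ⌊cutL x Δ P₀ n₁ n₂ / (s * r)⌋₊ < n ∧ r * s * n ≡ h [MOD q]), lamW h (r * s * n)

/-- The lower thin set `(n₁, (1+Δ)² n₁]`. [folklore] -/
noncomputable def thin₁ : Finset ℕ := Ioc ⌊n₁⌋₊ ⌊(1 + Δ) ^ 2 * n₁⌋₊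

/-- The upper thin set `(n₂/(1+Δ)², n₂]`. [folklore] -/
noncomputable def thin₂ : Finset ℕ := Ioc ⌊n₂ / (1 + Δ) ^ 2⌋₊ ⌊n₂⌋₊

variable {h q r s x Δ P₀ n₁ n₂}

/-- `0 ≤ L* ≤ M ≤ 2x` and `L* ≤ M`, for `x ≥ 0`, `P₀, n₂ ≥ 0`. [folklore] -/
theorem cutL_le_cutM : cutL x Δ P₀ n₁ n₂ ≤ cutM x P₀ n₂ := min_le_right _ _

/-- `0 ≤ L*` for `x ≥ 0`, `P₀ n₂ ≥ 0`. [folklore] -/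
theorem cutL_nonneg (hx : 0 ≤ x) (hP : 0 ≤ P₀ * n₂) : 0 ≤ cutL x Δ P₀ n₁ n₂ :=
  le_min (le_max_of_le_left hx) (le_min (by linarith) hP)

/-- `M ≤ 2x`. [folklore] -/
theorem cutM_le : cutM x P₀ n₂ ≤ 2 * x := min_le_left _ _

/-- **The local decomposition.**  Let `0 < P₀ < rs ≤ (1+Δ)² P₀`, `0 ≤ n₁ ≤ n₂`, `0 ≤ x`, `0 ≤ Δ`.
Then `|boxCrossSum − hypSum| ≤ #{n' ∈ thin₁ : rsn' ≡ h (q)} + #{n' ∈ thin₂ : rsn' ≡ h (q)}`.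
[folklore] -/
theorem boxCrossSum_decomp (hx : 0 ≤ x) (hΔ : 0 ≤ Δ) (hP₀ : 0 < P₀) (hrs1 : P₀ < (r : ℝ) * s)
    (hrs2 : (r : ℝ) * s ≤ (1 + Δ) ^ 2 * P₀) (hn₁ : 0 ≤ n₁) (hn₁₂ : n₁ ≤ n₂) :
    |boxCrossSum h q r s x n₁ n₂ - hypSum h q r s x Δ P₀ n₁ n₂| ≤
      (((thin₁ Δ n₁).filter (fun n => r * s * n ≡ h [MOD q])).card : ℝ) +
        (((thin₂ Δ n₂).filter (fun n => r * s * n ≡ h [MOD q])).card : ℝ) := by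
  classical
  set M := cutM x P₀ n₂ with hM
  set Ls := cutL x Δ P₀ n₁ n₂ with hLs
  have hr0 : 0 < r := by
    rcases Nat.eq_zero_or_pos r with h0 | h0
    · subst h0; simp at hrs1; linarith
    · exact h0
  have hs0 : 0 < s := by
    rcases Nat.eq_zero_or_pos s with h0 | h0
    · subst h0; simp at hrs1; linarith
    · exact h0
  have hrs0 : (0 : ℝ) < (r : ℝ) * s := hP₀.trans hrs1
  have hn₂ : 0 ≤ n₂ := hn₁.trans hn₁₂
  have hM0 : 0 ≤ M := le_min (by linarith) (mul_nonneg hP₀.le hn₂)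
  have hLs0 : 0 ≤ Ls := cutL_nonneg hx (mul_nonneg hP₀.le hn₂)
  have hM2x : M ≤ 2 * x := cutM_le
  -- predicates on `n`
  let box : ℕ → Prop := fun n => n₁ < n ∧ (n : ℝ) ≤ n₂
  let cross : ℕ → Prop := fun n => ⌊x⌋₊ < r * s * n ∧ r * s * n ≤ ⌊2 * x⌋₊
  let mainP : ℕ → Prop := fun n => Ls < (r : ℝ) * s * n ∧ (r : ℝ) * s * n ≤ M
  let cong : ℕ → Prop := fun n => r * s * n ≡ h [MOD q]
  let C1 : ℕ → Prop := fun n => (n₁ < n ∧ (n : ℝ) ≤ n₂) ∧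
    (⌊x⌋₊ < r * s * n ∧ r * s * n ≤ ⌊2 * x⌋₊ ∧ r * s * n ≡ h [MOD q])
  -- (F1) main ⇒ box ∧ cross
  have F1 : ∀ n : ℕ, 0 < n → mainP n → box n ∧ cross n := by
    intro n hn hm
    obtain ⟨h1, h2⟩ := hm
    have hn0 : (0 : ℝ) < n := by exact_mod_cast hn
    have hLM : Ls < M := h1.trans_le h2
    have hLs_eq : Ls = max x ((1 + Δ) ^ 2 * P₀ * n₁) := by
      have hdef : Ls = min (max x ((1 + Δ) ^ 2 * P₀ * n₁)) M := rfl
      rcases le_total (max x ((1 + Δ) ^ 2 * P₀ * n₁)) M with hle | hle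
      · rw [hdef, min_eq_left hle]
      · rw [hdef, min_eq_right hle] at hLM; exact absurd hLM (lt_irrefl _)
    have hx_lt : x < (r : ℝ) * s * n := lt_of_le_of_lt (hLs_eq ▸ le_max_left _ _) h1
    have hP_lt : (1 + Δ) ^ 2 * P₀ * n₁ < (r : ℝ) * s * n := lt_of_le_of_lt (hLs_eq ▸ le_max_right _ _) h1
    refine ⟨⟨?_, ?_⟩, ?_, ?_⟩
    · have : (r : ℝ) * s * n₁ ≤ (1 + Δ) ^ 2 * P₀ * n₁ := mul_le_mul_of_nonneg_right hrs2 hn₁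
      nlinarith
    · have hMP : M ≤ P₀ * n₂ := min_le_right _ _
      by_contra hgt
      rw [not_le] at hgt
      have : P₀ * n₂ < (r : ℝ) * s * n := by nlinarith
      linarith
    · exact (Nat.floor_lt hx).2 (by exact_mod_cast hx_lt)
    · exact Nat.le_floor (by push_cast; linarith)
  -- (F2) box ∧ cross ∧ ¬ main ⇒ thin
  have F2 : ∀ n : ℕ, 0 < n → box n → cross n → ¬ mainP n → n ∈ thin₁ Δ n₁ ∨ n ∈ thin₂ Δ n₂ := by
    intro n hn hb hcr hm
    obtain ⟨hb1, hb2⟩ := hb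
    obtain ⟨hc1, hc2⟩ := hcr
    have hn0 : (0 : ℝ) < n := by exact_mod_cast hn
    have hx_lt : x < (r : ℝ) * s * n := by
      have := (Nat.floor_lt hx).1 hc1; push_cast at this; exact this
    have h2x : (r : ℝ) * s * n ≤ 2 * x := by
      have := (Nat.le_floor_iff (by linarith : 0 ≤ 2 * x)).1 hc2; push_cast at this; exact this
    have hm' : (r : ℝ) * s * n ≤ Ls ∨ M < (r : ℝ) * s * n := by
      by_contra hcon
      push Not at hcon
      exact hm ⟨hcon.1, hcon.2⟩
    rcases hm' with hlow | hhigh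
    · left
      have hle : (r : ℝ) * s * n ≤ (1 + Δ) ^ 2 * P₀ * n₁ := by
        have h1 : Ls ≤ max x ((1 + Δ) ^ 2 * P₀ * n₁) := min_le_left _ _
        have h2 : (r : ℝ) * s * n ≤ max x ((1 + Δ) ^ 2 * P₀ * n₁) := hlow.trans h1
        rcases le_total x ((1 + Δ) ^ 2 * P₀ * n₁) with h3 | h3
        · rwa [max_eq_right h3] at h2
        · rw [max_eq_left h3] at h2; linarith
      unfold thin₁
      rw [Finset.mem_Ioc]
      constructor
      · exact (Nat.floor_lt hn₁).2 hb1
      · refine Nat.le_floor ?_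
        have : (r : ℝ) * s * n ≤ (r : ℝ) * s * ((1 + Δ) ^ 2 * n₁) := by nlinarith
        exact le_of_mul_le_mul_left this hrs0
    · right
      have hMeq : M = P₀ * n₂ := by
        have hMdef : M = min (2 * x) (P₀ * n₂) := rfl
        rcases le_total (2 * x) (P₀ * n₂) with h3 | h3
        · rw [hMdef, min_eq_left h3] at hhigh; linarith
        · rw [hMdef, min_eq_right h3]
      rw [hMeq] at hhigh
      unfold thin₂
      rw [Finset.mem_Ioc]
      constructor
      · refine (Nat.floor_lt (by positivity)).2 ?_
        rw [div_lt_iff₀ (by positivity)]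
        have : (r : ℝ) * s * n ≤ (1 + Δ) ^ 2 * P₀ * n := mul_le_mul_of_nonneg_right hrs2 hn0.le
        nlinarith
      · exact Nat.le_floor hb2
  -- split `boxCrossSum` into `main` + `rest`
  have hsplit : boxCrossSum h q r s x n₁ n₂ =
      (∑ n ∈ Ioc 0 ⌊2 * x⌋₊, if mainP n ∧ cong n then lamW h (r * s * n) else 0) +
      ∑ n ∈ Ioc 0 ⌊2 * x⌋₊, if (box n ∧ cross n ∧ ¬ mainP n) ∧ cong n then lamW h (r * s * n) else 0 := by
    unfold boxCrossSum
    rw [← Finset.sum_add_distrib]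
    refine Finset.sum_congr rfl fun n hn => ?_
    change (if C1 n then lamW h (r * s * n) else 0) = _
    have hn0 : 0 < n := (Finset.mem_Ioc.1 hn).1
    by_cases hc : cong n
    · by_cases hm : mainP n
      · obtain ⟨hb, hcr⟩ := F1 n hn0 hm
        rw [if_pos (show C1 n from ⟨hb, hcr.1, hcr.2, hc⟩), if_pos (show mainP n ∧ cong n from ⟨hm, hc⟩),
          if_neg (show ¬((box n ∧ cross n ∧ ¬ mainP n) ∧ cong n) from fun h' => h'.1.2.2 hm), add_zero]
      · by_cases hbc : box n ∧ cross n
        · rw [if_pos (show C1 n from ⟨hbc.1, hbc.2.1, hbc.2.2, hc⟩),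
            if_neg (show ¬(mainP n ∧ cong n) from fun h' => hm h'.1),
            if_pos (show (box n ∧ cross n ∧ ¬ mainP n) ∧ cong n from ⟨⟨hbc.1, hbc.2, hm⟩, hc⟩), zero_add]
        · rw [if_neg (show ¬ C1 n from fun h' => hbc ⟨h'.1, h'.2.1, h'.2.2.1⟩),
            if_neg (show ¬(mainP n ∧ cong n) from fun h' => hm h'.1),
            if_neg (show ¬((box n ∧ cross n ∧ ¬ mainP n) ∧ cong n) from fun h' => hbc ⟨h'.1.1, h'.1.2.1⟩),
            add_zero]
    · rw [if_neg (show ¬ C1 n from fun h' => hc h'.2.2.2), if_neg (show ¬(mainP n ∧ cong n) from fun h' => hc h'.2),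
        if_neg (show ¬((box n ∧ cross n ∧ ¬ mainP n) ∧ cong n) from fun h' => hc h'.2), add_zero]
  -- the main part is `hypSum`
  have hmain : (∑ n ∈ Ioc 0 ⌊2 * x⌋₊, if mainP n ∧ cong n then lamW h (r * s * n) else 0) =
      hypSum h q r s x Δ P₀ n₁ n₂ := by
    unfold hypSum
    rw [Finset.sum_filter]
    refine (sum_eq_sum_of_vanish (fun n hn hn' => ?_) (fun n hn hn' => ?_)).trans
      (Finset.sum_congr rfl fun n hn => ?_)
    · rw [if_neg]
      rintro ⟨hm, -⟩
      apply hn'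
      have := (mem_nRange_iff hr0 hs0 hLs0 hM0 (n := n)).2 hm
      exact Finset.mem_Icc.2 this.1
    · rw [if_neg]
      rintro ⟨hm, -⟩
      apply hn'
      have hn1 := (Finset.mem_Icc.1 hn).1
      rw [Finset.mem_Ioc]
      refine ⟨hn1, Nat.le_floor ?_⟩
      have h1 : (n : ℝ) ≤ (r : ℝ) * s * n := by
        have : (1 : ℝ) ≤ (r : ℝ) * s := by
          have h' : (1 : ℕ) ≤ r * s := Nat.one_le_iff_ne_zero.2 (Nat.mul_ne_zero hr0.ne' hs0.ne')
          exact_mod_cast h'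
        nlinarith [Nat.cast_nonneg (α := ℝ) n]
      linarith [hm.2]
    · by_cases hm : mainP n
      · have hfl : ⌊Ls / (s * r)⌋₊ < n := ((mem_nRange_iff hr0 hs0 hLs0 hM0 (n := n)).2 hm).2
        by_cases hc : cong n
        · rw [if_pos (show mainP n ∧ cong n from ⟨hm, hc⟩), if_pos (show ⌊Ls / (s * r)⌋₊ < n ∧ cong n from ⟨hfl, hc⟩)]
        · rw [if_neg (show ¬(mainP n ∧ cong n) from fun h' => hc h'.2),
            if_neg (show ¬(⌊Ls / (s * r)⌋₊ < n ∧ cong n) from fun h' => hc h'.2)]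
      · rw [if_neg (show ¬(mainP n ∧ cong n) from fun h' => hm h'.1), if_neg]
        rintro ⟨hfl, -⟩
        exact hm ((mem_nRange_iff hr0 hs0 hLs0 hM0 (n := n)).1 ⟨Finset.mem_Icc.1 hn, hfl⟩)
  -- the rest is supported on the thin sets
  have hrest : |∑ n ∈ Ioc 0 ⌊2 * x⌋₊, (if (box n ∧ cross n ∧ ¬ mainP n) ∧ cong n then lamW h (r * s * n) else 0)| ≤
      (((thin₁ Δ n₁).filter (fun n => r * s * n ≡ h [MOD q])).card : ℝ) +
        (((thin₂ Δ n₂).filter (fun n => r * s * n ≡ h [MOD q])).card : ℝ) := by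
    refine (Finset.abs_sum_le_sum_abs _ _).trans ?_
    have hpt : ∀ n ∈ Ioc 0 ⌊2 * x⌋₊,
        |(if (box n ∧ cross n ∧ ¬ mainP n) ∧ cong n then lamW h (r * s * n) else 0)| ≤
        (if n ∈ (thin₁ Δ n₁).filter (fun n => r * s * n ≡ h [MOD q]) then (1 : ℝ) else 0) +
        (if n ∈ (thin₂ Δ n₂).filter (fun n => r * s * n ≡ h [MOD q]) then (1 : ℝ) else 0) := by
      intro n hn
      have hn0 : 0 < n := (Finset.mem_Ioc.1 hn).1
      by_cases h1 : (box n ∧ cross n ∧ ¬ mainP n) ∧ cong n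
      · rw [if_pos h1]
        obtain ⟨⟨hb, hcr, hm⟩, hc⟩ := h1
        have hlam := abs_lamW_le_one h (r * s * n)
        rcases F2 n hn0 hb hcr hm with ht | ht
        · rw [if_pos (Finset.mem_filter.2 ⟨ht, hc⟩)]
          have : (0 : ℝ) ≤ if n ∈ (thin₂ Δ n₂).filter (fun n => r * s * n ≡ h [MOD q]) then (1 : ℝ) else 0 := by
            split_ifs <;> norm_num
          linarith
        · rw [if_pos (show n ∈ (thin₂ Δ n₂).filter (fun n => r * s * n ≡ h [MOD q]) from Finset.mem_filter.2 ⟨ht, hc⟩)]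
          have : (0 : ℝ) ≤ if n ∈ (thin₁ Δ n₁).filter (fun n => r * s * n ≡ h [MOD q]) then (1 : ℝ) else 0 := by
            split_ifs <;> norm_num
          linarith
      · rw [if_neg h1, abs_zero]
        have h2 : (0 : ℝ) ≤ if n ∈ (thin₁ Δ n₁).filter (fun n => r * s * n ≡ h [MOD q]) then (1 : ℝ) else 0 := by
          split_ifs <;> norm_num
        have h3 : (0 : ℝ) ≤ if n ∈ (thin₂ Δ n₂).filter (fun n => r * s * n ≡ h [MOD q]) then (1 : ℝ) else 0 := by
          split_ifs <;> norm_num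
        linarith
    refine (Finset.sum_le_sum hpt).trans ?_
    rw [Finset.sum_add_distrib]
    refine add_le_add ?_ ?_
    · rw [← Finset.sum_filter, Finset.sum_const, nsmul_eq_mul, mul_one]
      exact_mod_cast Finset.card_le_card (fun n hn => (Finset.mem_filter.1 hn).2)
    · rw [← Finset.sum_filter, Finset.sum_const, nsmul_eq_mul, mul_one]
      exact_mod_cast Finset.card_le_card (fun n hn => (Finset.mem_filter.1 hn).2)
  rw [hsplit, hmain, add_sub_cancel_left]
  exact hrest

end Local

end Summit.Parity.GeneralizedHardyLittlewood.Theorems.SieveToMAvg
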